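import Mathlib.Analysis.SpecialFunctions.Complex.LogDeriv
import Literature.Analysis.Calculus.SimpleRootBranchCubicVieta
import Literature.Analysis.Calculus.CornerClassEmbedding

/-!
# The regular local model: smooth germs at a regular torus point factor through the complex class data

Companion of `CornerClassEmbedding` (stabiliser `S₃`) and `WallClassEmbedding` (stabiliser `S₂`): at a base point
`b = (b₀, b₁, b₂)` whose eigenvalues `e^{ib_k}` are PAIRWISE DISTINCT (trivial stabiliser) every smooth germ
`g : (Fin 3 → ℝ) × P → E` — no symmetry required — factors through the class data
`S(x) = (Σ λ_k, Σ_{j<k} λ_jλ_k, Π λ_k)`, `λ_k = e^{i(b_k + x_k)}`: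
there are an open `W ∋ S(0)`, `F` smooth on `W × P` and `δ > 0` with `F (S x, z) = g (x, z)` for `‖x‖ < δ`.

Route: the three simple-root branches `r_k` of the cubic near `S(0)` (★ `exists_contDiffOn_cubicRoots_near`,
smooth implicit functions [Dieudonne1960, Ch. X §2]) recover the eigenvalues, `r_k (S x) = e^{i(b_k+x_k)}` for small `x`
(root matching by continuity and separation), and the principal logarithm recovers the offsets:
`x_k = Im log (r_k (S x) · e^{-ib_k})` for `|x_k| < π`; so `F(σ, z) := g ((Im log (r_k σ e^{-ib_k}))_k, z)`.
This is the regular stratum of Glaeser's theorem for the Weyl group of `U(3)` [Glaeser1963Newton, Thm. II],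
[Schwarz1975, Thm. 1], where no invariant theory is needed.
-/

noncomputable section

open Complex Set
open scoped ContDiff Topology

namespace Literature.Analysis.Calculus

/-! ## §1 Two small identities -/

/-- `e^{i(b+x)} · conj(e^{ib}) = e^{ix}`. [cite: Dieudonne1960, Ch. IX §5] -/
theorem cexp_add_mul_I_mul_conj (b x : ℝ) :
    Complex.exp ((((b + x : ℝ)) : ℂ) * I) * (starRingEnd ℂ) (Complex.exp ((b : ℂ) * I)) = Complex.exp ((x : ℂ) * I) := by
  rw [cexp_add_mul_I, mul_comm (Complex.exp _) (Complex.exp _), mul_assoc, mul_comm (Complex.exp ((b : ℂ) * I)), conj_cexp_mul_cexp, mul_one]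

/-- `Im log e^{ix} = x` for `-π < x ≤ π`. [cite: Dieudonne1960, Ch. IX §5] -/
theorem im_log_cexp_mul_I {x : ℝ} (h1 : -Real.pi < x) (h2 : x ≤ Real.pi) : (Complex.log (Complex.exp ((x : ℂ) * I))).im = x := by
  rw [Complex.log_exp] <;> simp [h1, h2]

/-! ## §2 The regular local model -/

universe u

variable {P : Type u} [NormedAddCommGroup P] [NormedSpace ℝ P] {E : Type u} [NormedAddCommGroup E] [NormedSpace ℝ E]

/-- **THE REGULAR LOCAL MODEL — SMOOTH GERMS AT A REGULAR TORUS POINT FACTOR THROUGH THE COMPLEX CLASS DATA.**  If the base eigenvalues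
`e^{ib_0}, e^{ib_1}, e^{ib_2}` are pairwise distinct then for every `C^∞` map `g : (Fin 3 → ℝ) × P → E` there are an open `W ⊆ ℂ³`, a function
`F` smooth on `W × P` and `δ > 0` with `S(x) ∈ W` and **`F (S x, z) = g (x, z)` for `‖x‖ < δ`**, `S(x) = (Σ λ_k, Σ_{j<k} λ_jλ_k, Π λ_k)`,
`λ_k = e^{i(b_k + x_k)}` (simple-root branches ★ `exists_contDiffOn_cubicRoots_near` + principal logarithm; here `P` need not be finite-dimensional nor `E` complete). [cite: Glaeser1963Newton, Thm. II]
[cite: Schwarz1975, Thm. 1] [cite: Dieudonne1960, Ch. X §2] -/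
theorem exists_contDiffOn_comp_regularClass (b : Fin 3 → ℝ)
    (hb : ∀ j k : Fin 3, j ≠ k → Complex.exp ((b j : ℂ) * I) ≠ Complex.exp ((b k : ℂ) * I))
    (g : (Fin 3 → ℝ) × P → E) (hg : ContDiff ℝ ∞ g) :
    ∃ W : Set (ℂ × ℂ × ℂ), IsOpen W ∧ ∃ F : (ℂ × ℂ × ℂ) × P → E, ContDiffOn ℝ ∞ F (W ×ˢ Set.univ) ∧
      ∃ δ > (0 : ℝ), ∀ x : Fin 3 → ℝ, ‖x‖ < δ → ∀ z : P, ((Complex.exp ((((b 0 + x 0 : ℝ)) : ℂ) * I) + Complex.exp ((((b 1 + x 1 : ℝ)) : ℂ) * I) + Complex.exp ((((b 2 + x 2 : ℝ)) : ℂ) * I),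
          Complex.exp ((((b 0 + x 0 : ℝ)) : ℂ) * I) * Complex.exp ((((b 1 + x 1 : ℝ)) : ℂ) * I) + Complex.exp ((((b 0 + x 0 : ℝ)) : ℂ) * I) * Complex.exp ((((b 2 + x 2 : ℝ)) : ℂ) * I) + Complex.exp ((((b 1 + x 1 : ℝ)) : ℂ) * I) * Complex.exp ((((b 2 + x 2 : ℝ)) : ℂ) * I),
          Complex.exp ((((b 0 + x 0 : ℝ)) : ℂ) * I) * Complex.exp ((((b 1 + x 1 : ℝ)) : ℂ) * I) * Complex.exp ((((b 2 + x 2 : ℝ)) : ℂ) * I)) : ℂ × ℂ × ℂ) ∈ W ∧ F (((Complex.exp ((((b 0 + x 0 : ℝ)) : ℂ) * I) + Complex.exp ((((b 1 + x 1 : ℝ)) : ℂ) * I) + Complex.exp ((((b 2 + x 2 : ℝ)) : ℂ) * I),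
          Complex.exp ((((b 0 + x 0 : ℝ)) : ℂ) * I) * Complex.exp ((((b 1 + x 1 : ℝ)) : ℂ) * I) + Complex.exp ((((b 0 + x 0 : ℝ)) : ℂ) * I) * Complex.exp ((((b 2 + x 2 : ℝ)) : ℂ) * I) + Complex.exp ((((b 1 + x 1 : ℝ)) : ℂ) * I) * Complex.exp ((((b 2 + x 2 : ℝ)) : ℂ) * I),
          Complex.exp ((((b 0 + x 0 : ℝ)) : ℂ) * I) * Complex.exp ((((b 1 + x 1 : ℝ)) : ℂ) * I) * Complex.exp ((((b 2 + x 2 : ℝ)) : ℂ) * I)) : ℂ × ℂ × ℂ), z) = g (x, z) := by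
  set Λ : Fin 3 → ℂ := fun k => Complex.exp ((b k : ℂ) * I) with hΛ
  set lam : (Fin 3 → ℝ) → Fin 3 → ℂ := fun x k => Complex.exp ((((b k + x k : ℝ)) : ℂ) * I) with hlam
  set S : (Fin 3 → ℝ) → ℂ × ℂ × ℂ := fun x =>
    (lam x 0 + lam x 1 + lam x 2, lam x 0 * lam x 1 + lam x 0 * lam x 2 + lam x 1 * lam x 2, lam x 0 * lam x 1 * lam x 2) with hS
  show ∃ W : Set (ℂ × ℂ × ℂ), IsOpen W ∧ ∃ F : (ℂ × ℂ × ℂ) × P → E, ContDiffOn ℝ ∞ F (W ×ˢ Set.univ) ∧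
      ∃ δ > (0 : ℝ), ∀ x : Fin 3 → ℝ, ‖x‖ < δ → ∀ z : P, S x ∈ W ∧ F (S x, z) = g (x, z)
  have hlam0 : ∀ k, lam 0 k = Λ k := by intro k; simp [hlam, hΛ]
  have hΛ1 : ∀ k, (starRingEnd ℂ) (Λ k) * Λ k = 1 := fun k => conj_cexp_mul_cexp (b k)
  -- (1) the simple-root branches near `S 0`
  have h1 : Λ 0 + Λ 1 + Λ 2 = (S 0).1 := by simp only [hS, hlam0]
  have h2 : Λ 0 * Λ 1 + Λ 0 * Λ 2 + Λ 1 * Λ 2 = (S 0).2.1 := by simp only [hS, hlam0]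
  have h3 : Λ 0 * Λ 1 * Λ 2 = (S 0).2.2 := by simp only [hS, hlam0]
  obtain ⟨U, hUo, hU0, r₁, r₂, r₃, hr₁, hr₂, hr₃, hr₁0, hr₂0, hr₃0, hvieta, -⟩ :=
    exists_contDiffOn_cubicRoots_near h1 h2 h3 (hb 0 1 (by decide)) (hb 0 2 (by decide)) (hb 1 2 (by decide))
  set r : Fin 3 → (ℂ × ℂ × ℂ → ℂ) := ![r₁, r₂, r₃] with hr
  have hrs : ∀ k, ContDiffOn ℝ ∞ (r k) U := by intro k; fin_cases k <;> assumption
  have hr0 : ∀ k, r k (S 0) = Λ k := by intro k; fin_cases k <;> assumption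
  -- (2) `W` and `F`
  set W : Set (ℂ × ℂ × ℂ) := ⋂ k : Fin 3, (U ∩ {σ | r k σ * (starRingEnd ℂ) (Λ k) ∈ Complex.slitPlane}) with hW
  have hWo : IsOpen W := by
    refine isOpen_iInter_of_finite fun k => ?_
    exact ((hrs k).continuousOn.mul continuousOn_const).isOpen_inter_preimage hUo Complex.isOpen_slitPlane
  have hWU : ∀ σ ∈ W, σ ∈ U := fun σ hσ => ((Set.mem_iInter.1 hσ) 0).1
  have hWk : ∀ σ ∈ W, ∀ k, r k σ * (starRingEnd ℂ) (Λ k) ∈ Complex.slitPlane := fun σ hσ k => ((Set.mem_iInter.1 hσ) k).2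
  have hS0W : S 0 ∈ W := by
    refine Set.mem_iInter.2 fun k => ⟨hU0, ?_⟩
    show r k (S 0) * (starRingEnd ℂ) (Λ k) ∈ Complex.slitPlane
    rw [hr0, mul_comm, hΛ1]
    exact Complex.one_mem_slitPlane
  refine ⟨W, hWo, fun q => g (fun k => (Complex.log (r k q.1 * (starRingEnd ℂ) (Λ k))).im, q.2), ?_, ?_⟩
  · -- smoothness on `W × P`
    refine hg.comp_contDiffOn (ContDiffOn.prodMk (contDiffOn_pi.2 fun k => ?_) contDiffOn_snd)
    have hrk : ContDiffOn ℝ ∞ (fun q : (ℂ × ℂ × ℂ) × P => r k q.1 * (starRingEnd ℂ) (Λ k)) (W ×ˢ Set.univ) :=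
      ((hrs k).comp contDiff_fst.contDiffOn fun q hq => hWU _ (Set.mem_prod.1 hq).1).mul contDiffOn_const
    intro q hq
    have hsl := hWk _ (Set.mem_prod.1 hq).1 k
    exact Complex.imCLM.contDiff.contDiffAt.comp_contDiffWithinAt q
      (((Complex.contDiffAt_log hsl).restrict_scalars ℝ).comp_contDiffWithinAt q (hrk q hq))
  · -- `δ`
    have hlc : ∀ k, Continuous fun x : Fin 3 → ℝ => lam x k := by
      intro k
      simp only [hlam]
      fun_prop
    have hSc : Continuous S :=
      (((hlc 0).add (hlc 1)).add (hlc 2)).prodMk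
        (((((hlc 0).mul (hlc 1)).add ((hlc 0).mul (hlc 2))).add ((hlc 1).mul (hlc 2))).prodMk (((hlc 0).mul (hlc 1)).mul (hlc 2)))
    have hrat : ∀ k, ContinuousAt (fun x => r k (S x)) 0 := fun k =>
      ContinuousAt.comp (g := r k) (f := S) (x := (0 : Fin 3 → ℝ)) ((hrs k).continuousOn.continuousAt (hUo.mem_nhds hU0)) hSc.continuousAt
    -- separation
    set ρ : ℝ := min (min ‖Λ 0 - Λ 1‖ ‖Λ 0 - Λ 2‖) ‖Λ 1 - Λ 2‖ / 2 with hρ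
    have hρpos : 0 < ρ := by
      have a := norm_sub_pos_iff.2 (hb 0 1 (by decide))
      have b' := norm_sub_pos_iff.2 (hb 0 2 (by decide))
      have c := norm_sub_pos_iff.2 (hb 1 2 (by decide))
      rw [hρ]; positivity
    have hρle : ∀ j k : Fin 3, j ≠ k → 2 * ρ ≤ ‖Λ j - Λ k‖ := by
      intro j k hjk
      have e2 : 2 * ρ = min (min ‖Λ 0 - Λ 1‖ ‖Λ 0 - Λ 2‖) ‖Λ 1 - Λ 2‖ := by rw [hρ]; ring
      rw [e2]
      fin_cases j <;> fin_cases k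
      all_goals first | exact absurd rfl hjk | skip
      · exact (min_le_left _ _).trans (min_le_left _ _)
      · exact (min_le_left _ _).trans (min_le_right _ _)
      · exact (min_le_left _ _).trans ((min_le_left _ _).trans (le_of_eq (norm_sub_rev (Λ 0) (Λ 1))))
      · exact min_le_right _ _
      · exact (min_le_left _ _).trans ((min_le_right _ _).trans (le_of_eq (norm_sub_rev (Λ 0) (Λ 2))))
      · exact (min_le_right _ _).trans (le_of_eq (norm_sub_rev (Λ 1) (Λ 2)))
    -- the neighbourhoods
    have N1 : S ⁻¹' W ∈ nhds (0 : Fin 3 → ℝ) := hSc.continuousAt.preimage_mem_nhds (hWo.mem_nhds hS0W)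
    have N2 : ∀ k, (fun x => r k (S x)) ⁻¹' Metric.ball (Λ k) ρ ∈ nhds (0 : Fin 3 → ℝ) := by
      intro k
      refine (hrat k).preimage_mem_nhds (Metric.isOpen_ball.mem_nhds ?_)
      show r k (S 0) ∈ Metric.ball (Λ k) ρ
      rw [hr0]; exact Metric.mem_ball_self hρpos
    have N3 : ∀ k, (fun x => lam x k) ⁻¹' Metric.ball (Λ k) ρ ∈ nhds (0 : Fin 3 → ℝ) := by
      intro k
      refine (hlc k).continuousAt.preimage_mem_nhds (Metric.isOpen_ball.mem_nhds ?_)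
      show lam 0 k ∈ Metric.ball (Λ k) ρ
      rw [hlam0]; exact Metric.mem_ball_self hρpos
    obtain ⟨δ₀, hδ₀, hball⟩ := Metric.mem_nhds_iff.1 (Filter.inter_mem N1 (Filter.inter_mem ((Filter.iInter_mem).2 N2) ((Filter.iInter_mem).2 N3)))
    refine ⟨min δ₀ Real.pi, lt_min hδ₀ Real.pi_pos, fun x hx z => ?_⟩
    have hx₀ : ‖x‖ < δ₀ := lt_of_lt_of_le hx (min_le_left _ _)
    have hxπ : ‖x‖ < Real.pi := lt_of_lt_of_le hx (min_le_right _ _)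
    obtain ⟨hxW, hx2, hx3⟩ := hball (by rwa [Metric.mem_ball, dist_zero_right] : x ∈ Metric.ball (0 : Fin 3 → ℝ) δ₀)
    have hxW' : S x ∈ W := hxW
    have hrn : ∀ k, ‖r k (S x) - Λ k‖ < ρ := fun k => by
      have h := (Set.mem_iInter.1 hx2) k
      rwa [Set.mem_preimage, Metric.mem_ball, dist_eq_norm] at h
    have hln : ∀ k, ‖lam x k - Λ k‖ < ρ := fun k => by
      have h := (Set.mem_iInter.1 hx3) k
      rwa [Set.mem_preimage, Metric.mem_ball, dist_eq_norm] at h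
    -- (3) root matching `r k (S x) = λ_k(x)`
    obtain ⟨v1, v2, v3⟩ := hvieta (S x) (hWU _ hxW')
    have hz : ∀ k, lam x k ^ 3 - (S x).1 * lam x k ^ 2 + (S x).2.1 * lam x k - (S x).2.2 = 0 := by
      intro k
      rw [cubic_eq_prod_of_vieta (r₁ := lam x 0) (r₂ := lam x 1) (r₃ := lam x 2) rfl rfl rfl]
      fin_cases k <;> simp
    have hex : ∀ j k, lam x k = r j (S x) → j = k := by
      intro j k h
      by_contra hjk
      have h2ρ := hρle j k hjk
      have ha : ‖Λ j - lam x k‖ < ρ := by rw [norm_sub_rev, h]; exact hrn j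
      have hb' := hln k
      have := norm_sub_le_norm_sub_add_norm_sub (Λ j) (lam x k) (Λ k)
      linarith
    have hroot : ∀ k, r k (S x) = lam x k := by
      intro k
      rcases eq_or_eq_or_eq_of_cubic_eq_zero v1 v2 v3 (hz k) with h | h | h
      · obtain rfl := hex 0 k h; exact h.symm
      · obtain rfl := hex 1 k h; exact h.symm
      · obtain rfl := hex 2 k h; exact h.symm
    refine ⟨hxW', ?_⟩
    -- (4) the offsets from the principal logarithm
    have harg : (fun k => (Complex.log (r k (S x) * (starRingEnd ℂ) (Λ k))).im) = x := by
      funext k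
      have hk : |x k| < Real.pi := lt_of_le_of_lt (by simpa [Real.norm_eq_abs] using norm_le_pi_norm x k) hxπ
      rw [hroot k]
      show (Complex.log (Complex.exp ((((b k + x k : ℝ)) : ℂ) * I) * (starRingEnd ℂ) (Complex.exp ((b k : ℂ) * I)))).im = x k
      rw [cexp_add_mul_I_mul_conj]
      exact im_log_cexp_mul_I (abs_lt.1 hk).1 (abs_lt.1 hk).2.le
    show g (fun k => (Complex.log (r k (S x) * (starRingEnd ℂ) (Λ k))).im, z) = g (x, z)
    rw [harg]

end Literature.Analysis.Calculus

end
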